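import Summits.KontsevichZagierPeriods.KontsevichZagierPeriods.Theorems.SoloInformedH3FromEquidim
import Literature.NumberTheory.Transcendental.KZGroundingRelations
import HarnessLib
import HarnessLib.Audit

/-!
# SoloInformed — grounding inside the scissors calculus `𝒮`, I: one smooth cell (COMPACTIFICATION LEMMA, part 1 of 3)

Solo programme `solo-KontsevichZagierPeriods-informed`, session s261 (file 1 of 3).

The scissors calculus `𝒮 = soloInformedScissorsRel` is generated by the two *equidimensional,
density-free* moves on volume representations (integrand `≡ 1`): cutting along `ℚ`-semialgebraic
sets up to null sets, and volume-preserving `ℚ`-semialgebraic `C¹` bijections (`|det| = 1`).  The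
Literature file `KZGroundingRelations` shows that every finite-volume `ℚ`-semialgebraic set is
KZ-equivalent (inside the full four-move calculus `relations`, using the Newton–Leibniz rule twice per
cell) to a coordinatewise down-set of the positive orthant.  This file and its sequel
`SoloInformedScissorsGroundAll` prove the same congruence **inside `𝒮`**, i.e. without the
Newton–Leibniz rule and without ever changing the dimension:

* `soloInformed_of_sub_of_mem_scissorsRel_perm` — coordinate permutations are `𝒮`-moves;
* `soloInformed_under_sum_mem_scissorsRel` — iterated STACKING: `[U(∑ qⱼ)] ≡ ∑ [U(qⱼ)]` in `𝒮`;
* `soloInformed_of_sub_of_mem_scissorsRel_smoothCell` — over one open cell `C` carrying smooth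
  sections of an adapted cylindrical decomposition, `[S ∩ (C × ℝ)] ≡ [groundLast S ∩ (C × ℝ)]` in
  `𝒮`: cut into the open bands, SHEAR each band `{ξ_{j-1} < t < ξ_j}` down onto the region under the
  graph of its width (a volume-preserving `ℚ`-semialgebraic `C¹` map,
  `soloInformed_exists_shear_of_under`), and STACK the widths
  (`soloInformed_under_stack_mem_scissorsRel`); the result is `groundLast S` over the cell up to two
  null graphs.

References: [Kontsevich–Zagier 2001, §1.2] (the moves); [Basu–Pollack–Roy 2006, §5.1] (cylindrical
decomposition); the tree files `KZGroundingRelations`, `SemialgebraicGrounding` (set-level grounding,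
whose cell-by-cell bookkeeping is followed verbatim); this work (COROLLARY NF.2, the calculus `𝒮`;
`nl-elimination.md` NF.4(3), the COMPACTIFICATION LEMMA).
-/

noncomputable section

open scoped BigOperators Topology ContDiff ENNReal

namespace Summit.KontsevichZagierPeriods.KontsevichZagierPeriods.Theorems

open Set MeasureTheory Filter
open Literature.ModelTheory.ExponentialFields
open Literature.NumberTheory.Transcendental Literature.NumberTheory.Transcendental.KZ

variable {m n : ℕ}

/-! ### Small tools -/

/-- Differences of sums: if `aᵢ − bᵢ ∈ 𝒮` for all `i ∈ s` then `∑ aᵢ − ∑ bᵢ ∈ 𝒮`. [folklore] -/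
theorem soloInformed_sum_sub_sum_mem_scissorsRel {ι : Type*} (s : Finset ι) (a b : ι → FormalRep)
    (h : ∀ i ∈ s, a i - b i ∈ soloInformedScissorsRel) :
    ∑ i ∈ s, a i - ∑ i ∈ s, b i ∈ soloInformedScissorsRel := by
  rw [← Finset.sum_sub_distrib]
  exact AddSubgroup.sum_mem _ h

/-! ### Coordinate permutations are `𝒮`-moves -/

/-- **Coordinate permutations are volume-preserving-map moves.** For a permutation `σ` of the
coordinates and volume representations `r = (S, 1)`, `r' = (perm σ S, 1)`, `[r] − [r'] ∈ 𝒮`: the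
linear map `x ↦ x ∘ σ⁻¹` is `ℚ`-semialgebraic, injective and has `|det| = 1`
(`Measure.addHaar_image_continuousLinearMap`); when `vol S = 0` both sides are null.
[Kontsevich–Zagier 2001, §1.2, rule (2); this work] -/
theorem soloInformed_of_sub_of_mem_scissorsRel_perm (σ : Equiv.Perm (Fin (m + 1)))
    (r r' : IntegralRep (m + 1)) (h1 : SoloInformedIsVolRep r)
    (hd : r'.domain = Grounding.perm σ r.domain) (h1' : SoloInformedIsVolRep r') :
    of r - of r' ∈ soloInformedScissorsRel := by
  have hSm : MeasurableSet r.domain := IntegralRep.measurableSet_domain_holds r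
  have hvol : volume r'.domain = volume r.domain := by rw [hd, Grounding.volume_perm σ hSm]
  by_cases h0 : volume r.domain = 0
  · exact sub_mem (soloInformed_of_mem_scissorsRel_of_volume_eq_zero h1 h0)
      (soloInformed_of_mem_scissorsRel_of_volume_eq_zero h1' (hvol.trans h0))
  have hfin : volume r.domain ≠ ⊤ := volume_ne_top_of_integrand_one r h1
  -- the linear map `x ↦ x ∘ σ⁻¹`
  set L : (Fin (m + 1) → ℝ) →L[ℝ] (Fin (m + 1) → ℝ) :=
    LinearMap.toContinuousLinearMap (LinearMap.funLeft ℝ ℝ σ.symm) with hL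
  have hLapply : ∀ x, L x = x ∘ σ.symm := fun x => by
    rw [hL, LinearMap.coe_toContinuousLinearMap']
    rfl
  have himage : L '' r.domain = r'.domain := by
    rw [hd]
    ext y
    simp only [mem_image, hLapply, Grounding.mem_perm]
    constructor
    · rintro ⟨x, hx, rfl⟩
      have : (x ∘ σ.symm) ∘ σ = x := by ext i; simp
      rwa [this]
    · intro hy
      refine ⟨y ∘ σ, hy, ?_⟩
      ext i; simp
  have hLsa : IsSemialgebraicMapOn ℚ r.domain L := by
    refine (isSemialgebraicMapOn_aeval r.isSemialgebraic_domain fun j => MvPolynomial.X (σ.symm j)).congr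
      fun x _ => ?_
    rw [hLapply]
    ext j
    simp
  have hLinj : InjOn L r.domain := by
    intro x _ y _ hxy
    rw [hLapply, hLapply] at hxy
    have := congr_arg (fun f : Fin (m + 1) → ℝ => f ∘ σ) hxy
    simpa [Function.comp_assoc] using this
  -- `|det L| = 1` by volume preservation
  have hdet : |L.det| = 1 := by
    have h := Measure.addHaar_image_continuousLinearMap volume L r.domain
    rw [himage, hvol] at h
    have h' : ENNReal.ofReal |LinearMap.det (L : (Fin (m + 1) → ℝ) →ₗ[ℝ] (Fin (m + 1) → ℝ))| = 1 := by
      have := (ENNReal.mul_eq_right h0 hfin).1 h.symm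
      exact this
    exact ENNReal.ofReal_eq_one.1 h'
  exact soloInformed_mapGen_subset_scissorsRel (soloInformed_mem_mapGen h1 h1' L (fun _ => L) hLsa
    (fun _ _ => L.hasFDerivWithinAt) hLinj himage.symm fun _ _ => hdet)

/-! ### Iterated stacking -/

/-- **Iterated stacking.** For densities `b i = [V, qᵢ]` (`i ∈ s`) on a common domain `V` with
`qᵢ ≥ 0` differentiable at the points of `V`, and `a = [V, ∑ᵢ qᵢ]`:
`[U(a)] − ∑ᵢ [U(b i)] ∈ 𝒮` (induction on `s` by the stacking lemma
`soloInformed_under_stack_mem_scissorsRel`). [this work, COROLLARY NF.2] -/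
theorem soloInformed_under_sum_mem_scissorsRel {ι : Type*} (s : Finset ι) (V : Set (Fin n → ℝ))
    (hV : IsSemialgebraic ℚ V) (b : ι → IntegralRep n) (hbd : ∀ i ∈ s, (b i).domain = V)
    (hb0 : ∀ i ∈ s, ∀ x ∈ V, 0 ≤ (b i).integrand x)
    (hbd' : ∀ i ∈ s, ∀ x ∈ V, HasFDerivAt (b i).integrand (fderiv ℝ (b i).integrand x) x)
    (a : IntegralRep n) (had : a.domain = V)
    (hai : ∀ x ∈ V, a.integrand x = ∑ i ∈ s, (b i).integrand x) :
    of (soloInformedUnder a) - ∑ i ∈ s, of (soloInformedUnder (b i)) ∈ soloInformedScissorsRel := by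
  classical
  induction s using Finset.induction_on generalizing a with
  | empty =>
    rw [Finset.sum_empty, sub_zero]
    refine soloInformed_of_under_mem_scissorsRel_of_nonpos a fun x hx => ?_
    rw [had] at hx
    rw [hai x hx, Finset.sum_empty]
  | insert i s hi ih =>
    -- the density `c = [V, ∑_{s} q]`
    let c : IntegralRep n :=
      { domain := V
        integrand := fun x => ∑ i ∈ s, (b i).integrand x
        isSemialgebraic_domain := hV
        isSemialgebraicFunOn_integrand := isSemialgebraicFunOn_finset_sum s hV fun i hi' =>
          hbd i (Finset.mem_insert_of_mem hi') ▸ (b i).isSemialgebraicFunOn_integrand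
        integrableOn := integrable_finsetSum s fun i hi' =>
          hbd i (Finset.mem_insert_of_mem hi') ▸ (b i).integrableOn }
    have hc : of (soloInformedUnder c) - ∑ i ∈ s, of (soloInformedUnder (b i)) ∈
        soloInformedScissorsRel :=
      ih (fun i hi' => hbd i (Finset.mem_insert_of_mem hi'))
        (fun i hi' => hb0 i (Finset.mem_insert_of_mem hi'))
        (fun i hi' => hbd' i (Finset.mem_insert_of_mem hi')) c rfl fun x _ => rfl
    have hstack : of (soloInformedUnder a) - of (soloInformedUnder (b i)) - of (soloInformedUnder c) ∈
        soloInformedScissorsRel := by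
      refine soloInformed_under_stack_mem_scissorsRel a (b i) c
        (p' := fun x => fderiv ℝ (b i).integrand x) (by rw [had, hbd i (Finset.mem_insert_self i s)])
        (by rw [had]) (fun x hx => ?_) (fun x hx => ?_) (fun x hx => ?_) (fun x hx => ?_)
      · rw [had] at hx
        rw [hai x hx, Finset.sum_insert hi]
      · rw [had] at hx
        exact hb0 i (Finset.mem_insert_self i s) x hx
      · rw [had] at hx
        exact Finset.sum_nonneg fun i' hi' => hb0 i' (Finset.mem_insert_of_mem hi') x hx
      · rw [had] at hx
        exact hbd' i (Finset.mem_insert_self i s) x hx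
    rw [Finset.sum_insert hi]
    have e : of (soloInformedUnder a) - (of (soloInformedUnder (b i)) +
        ∑ i ∈ s, of (soloInformedUnder (b i))) =
        (of (soloInformedUnder a) - of (soloInformedUnder (b i)) - of (soloInformedUnder c)) +
        (of (soloInformedUnder c) - ∑ i ∈ s, of (soloInformedUnder (b i))) := by abel
    rw [e]
    exact add_mem hstack hc

/-! ### Grounding the last coordinate over one cell, in `𝒮` -/

/-- **Grounding over one smooth cell, in `𝒮`.** Let `S` be `ℚ`-semialgebraic of finite volume,
`C` an OPEN `ℚ`-semialgebraic cell of `ℝ^m` with `ℚ`-semialgebraic increasing `C^∞` sections `ξ`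
over which the vertical fibres of `S` are the graphs `j ∈ G` and the bands `j ∈ B`. Then the volume
representations `(S ∩ (C × ℝ), 1)` and `(groundLast S ∩ (C × ℝ), 1)` are scissors congruent: both are
null if `vol C = 0`; otherwise all bands are inner, and
`[S ∩ (C × ℝ)] ≡ ∑_{j ∈ B} [band_j] ≡ ∑_j [U(C, ξ_j − ξ_{j-1})] ≡ [U(C, L)] ≡ [groundLast S ∩ (C × ℝ)]`
by a null modification, scissors, one SHEAR per band, STACKING, and a null modification, where
`L = ∑_j (ξ_j − ξ_{j-1})` is the fibre length. [Kontsevich–Zagier 2001, §1.2; this work] -/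
theorem soloInformed_of_sub_of_mem_scissorsRel_smoothCell {l : ℕ} {S : Set (Fin (m + 1) → ℝ)}
    (hS : IsSemialgebraic ℚ S) (hfin : volume S ≠ ⊤) {C : Set (Fin m → ℝ)}
    (hC : IsSemialgebraic ℚ C) (hCo : IsOpen C) (ξ : Fin l → (Fin m → ℝ) → ℝ)
    (hξ : ∀ i, IsSemialgebraicFunOn ℚ C (ξ i)) (hsm : ∀ i, ContDiffOn ℝ ∞ (ξ i) C)
    (hmono : ∀ x ∈ C, StrictMono fun i => ξ i x) (G : Finset (Fin l)) (B : Finset (Fin (l + 1)))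
    (hBsub : ∀ j ∈ B, bandOver C ξ j ⊆ S) (hBsa : ∀ j, IsSemialgebraic ℚ (bandOver C ξ j))
    (hfib : ∀ x ∈ C, {t : ℝ | (Fin.snoc x t : Fin (m + 1) → ℝ) ∈ S} = (⋃ j ∈ G, {ξ j x}) ∪
      ⋃ j ∈ B, {t : ℝ | bandLower ξ j x < (t : EReal) ∧ (t : EReal) < bandUpper ξ j x})
    (r r' : IntegralRep (m + 1)) (hrd : r.domain = S ∩ {z | Fin.init z ∈ C})
    (hr1 : SoloInformedIsVolRep r)
    (hr'd : r'.domain = Grounding.groundLast S ∩ {z | Fin.init z ∈ C})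
    (hr'1 : SoloInformedIsVolRep r') : of r - of r' ∈ soloInformedScissorsRel := by
  classical
  have hSm : MeasurableSet S := IsSemialgebraic.measurableSet_holds hS
  have hCm : MeasurableSet C := IsSemialgebraic.measurableSet_holds hC
  by_cases hC0 : volume C = 0
  · -- both pieces are null
    have hcyl := volume_setOf_init_mem_eq_zero (n := m) hC0
    refine sub_mem (soloInformed_of_mem_scissorsRel_of_volume_eq_zero hr1 ?_)
      (soloInformed_of_mem_scissorsRel_of_volume_eq_zero hr'1 ?_)
    · rw [hrd]; exact measure_mono_null inter_subset_right hcyl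
    · rw [hr'd]; exact measure_mono_null inter_subset_right hcyl
  -- all bands over `C` are inner
  have hinner : ∀ j ∈ B, j ≠ 0 ∧ j ≠ Fin.last l := fun j hj =>
    ne_zero_and_ne_last_of_bandOver_subset hSm hfin hCm hC0 ξ (hBsub j hj)
  -- the open bands, as volume representations
  have hOb : ∀ j : {j // j ∈ B}, ∃ Ob : IntegralRep (m + 1),
      Ob.domain = bandOver C ξ j ∧ Ob.integrand = fun _ => 1 := fun j =>
    exists_oneRep (hBsa j) ((measure_mono (hBsub j j.2)).trans_lt hfin.lt_top).ne
  choose Ob hObd hObi using hOb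
  have hObv : ∀ j, SoloInformedIsVolRep (Ob j) := fun j x _ => by rw [hObi]
  -- Step 0: discard the graphs over `C` (a null set): restrict `r` to the union of the open bands
  set U : Set (Fin (m + 1) → ℝ) := ⋃ j ∈ B.attach, (Ob j).domain with hU
  have hUsa : IsSemialgebraic ℚ U :=
    IsSemialgebraic.biUnion B.attach (fun j => (Ob j).domain) fun j _ => (Ob j).isSemialgebraic_domain
  have hUsub : U ⊆ r.domain := by
    rw [hrd]
    refine iUnion₂_subset fun j _ z hz => ?_
    rw [hObd] at hz
    exact ⟨hBsub j j.2 hz, (mem_bandOver_iff.1 hz).1⟩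
  set rU : IntegralRep (m + 1) := r.restrict U hUsa hUsub with hrU_def
  have hrUv : SoloInformedIsVolRep rU := fun x hx => hr1 x (hUsub hx)
  have e0 : of r - of rU ∈ soloInformedScissorsRel := by
    refine soloInformed_of_sub_of_mem_scissorsRel_of_subset hr1 hrUv hUsub ?_
    have hsub : r.domain \ U ⊆
        ⋃ j ∈ G, {z : Fin (m + 1) → ℝ | Fin.init z ∈ C ∧ z (Fin.last m) = ξ j (Fin.init z)} := by
      intro z hz
      rw [hrd] at hz
      obtain ⟨⟨hzS, hzC⟩, hzU⟩ := hz
      have hzC : Fin.init z ∈ C := hzC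
      have ht : z (Fin.last m) ∈ {t : ℝ | (Fin.snoc (Fin.init z) t : Fin (m + 1) → ℝ) ∈ S} := by
        show Fin.snoc (Fin.init z) (z (Fin.last m)) ∈ S
        rw [Fin.snoc_init_self]; exact hzS
      rw [hfib _ hzC] at ht
      rcases ht with ht | ht
      · simp only [mem_iUnion, mem_singleton_iff, exists_prop] at ht
        obtain ⟨j, hj, hjt⟩ := ht
        exact mem_iUnion₂.2 ⟨j, hj, hzC, hjt⟩
      · simp only [mem_iUnion, mem_setOf_eq, exists_prop] at ht
        obtain ⟨j, hj, hjt⟩ := ht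
        exact absurd (mem_iUnion₂.2 ⟨⟨j, hj⟩, Finset.mem_attach _ _, by
          rw [hObd]; exact mem_bandOver_iff.2 ⟨hzC, hjt.1, hjt.2⟩⟩) hzU
    refine measure_mono_null hsub ((measure_biUnion_null_iff G.countable_toSet).2 fun j _ => ?_)
    exact volume_graph_eq_zero (hξ j)
  -- Step 1: cut `U` into the open bands
  have e1 : of rU - ∑ j ∈ B.attach, of (Ob j) ∈ soloInformedScissorsRel := by
    refine soloInformed_of_sub_sum_of_mem_scissorsRel B.attach Ob rU hrUv (fun j _ => hObv j) rfl ?_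
    intro j _ j' _ hne
    have hne' : (j : Fin (l + 1)) ≠ j' := fun h => hne (Subtype.ext h)
    have : (Ob j).domain ∩ (Ob j').domain = ∅ := by
      rw [hObd, hObd]
      ext z
      simp only [mem_inter_iff, mem_empty_iff_false, iff_false, not_and]
      intro hz hz'
      rw [mem_bandOver_iff] at hz hz'
      exact (Set.disjoint_left.1 (disjoint_bandFibre ξ (hmono _ hz.1) hne')) ⟨hz.2.1, hz.2.2⟩
        ⟨hz'.2.1, hz'.2.2⟩
    rw [this, measure_empty]
  -- Step 2: the widths `b j = [C, ξ_j − ξ_{j-1}]` and the closed bands as SHEARS of `U(b j)`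
  have hBb : ∀ j : {j // j ∈ B}, ∃ (Bd : IntegralRep (m + 1)) (b : IntegralRep m),
      Bd.domain = KZlog.band C (fun x => (bandLower ξ j x).toReal)
        (fun x => (bandUpper ξ j x).toReal) ∧
      (Bd.integrand = fun _ => 1) ∧ b.domain = C ∧
      (b.integrand = fun x => (bandUpper ξ j x).toReal - (bandLower ξ j x).toReal) ∧
      of Bd - of b ∈ newtonLeibnizRel := fun j =>
    exists_band_sub_base_mem_newtonLeibnizRel hfin hC ξ hξ hmono (hinner j j.2).1 (hinner j j.2).2
      (hBsub j j.2)
  choose Bd b hBdd hBdi hbd hbi hNL using hBb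
  have hlo : ∀ (j : {j // j ∈ B}) (x : Fin m → ℝ),
      (bandLower ξ j x).toReal = ξ ((j : Fin (l + 1)).pred (hinner j j.2).1) x := fun j x => by
    rw [bandLower_of_ne_zero ξ j (hinner j j.2).1, EReal.toReal_coe]
  have hhi : ∀ (j : {j // j ∈ B}) (x : Fin m → ℝ),
      (bandUpper ξ j x).toReal = ξ ((j : Fin (l + 1)).castPred (hinner j j.2).2) x := fun j x => by
    rw [bandUpper_of_ne_last ξ j (hinner j j.2).2, EReal.toReal_coe]
  have hlosa : ∀ j : {j // j ∈ B}, IsSemialgebraicFunOn ℚ C fun x => (bandLower ξ j x).toReal :=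
    fun j => (hξ _).congr fun x _ => (hlo j x).symm
  have hhisa : ∀ j : {j // j ∈ B}, IsSemialgebraicFunOn ℚ C fun x => (bandUpper ξ j x).toReal :=
    fun j => (hξ _).congr fun x _ => (hhi j x).symm
  have hlod : ∀ j : {j // j ∈ B}, ∀ x ∈ C, HasFDerivAt (fun x => (bandLower ξ j x).toReal)
      (fderiv ℝ (ξ ((j : Fin (l + 1)).pred (hinner j j.2).1)) x) x := fun j x hx => by
    have : (fun x => (bandLower ξ j x).toReal) = ξ ((j : Fin (l + 1)).pred (hinner j j.2).1) :=
      funext (hlo j)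
    rw [this]
    exact soloInformed_hasFDerivAt_of_contDiffOn' hCo (hsm _) hx
  have hwd : ∀ j : {j // j ∈ B}, ∀ x ∈ C,
      HasFDerivAt (b j).integrand (fderiv ℝ (b j).integrand x) x := fun j x hx => by
    have : (b j).integrand = fun x => ξ ((j : Fin (l + 1)).castPred (hinner j j.2).2) x -
        ξ ((j : Fin (l + 1)).pred (hinner j j.2).1) x := by
      rw [hbi]
      funext x
      rw [hlo, hhi]
    rw [this]
    exact ((soloInformed_hasFDerivAt_of_contDiffOn' hCo (hsm _) hx).sub
      (soloInformed_hasFDerivAt_of_contDiffOn' hCo (hsm _) hx)).differentiableAt.hasFDerivAt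
  have hb0 : ∀ j : {j // j ∈ B}, ∀ x ∈ C, 0 ≤ (b j).integrand x := fun j x hx => by
    rw [hbi]
    exact (sub_pos.2 (toReal_bandLower_lt_toReal_bandUpper ξ (hmono x hx) (hinner j j.2).1
      (hinner j j.2).2)).le
  have hM : ∀ j : {j // j ∈ B}, ∃ M : IntegralRep (m + 1), SoloInformedIsVolRep M ∧
      M.domain = {w : Fin (m + 1) → ℝ | Fin.init w ∈ (b j).domain ∧
        (bandLower ξ j (Fin.init w)).toReal ≤ w (Fin.last m) ∧
        w (Fin.last m) ≤ (bandLower ξ j (Fin.init w)).toReal + (b j).integrand (Fin.init w)} ∧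
      of (soloInformedUnder (b j)) - of M ∈ soloInformedMapGen := fun j =>
    soloInformed_exists_shear_of_under (b j) (f := fun x => (bandLower ξ j x).toReal)
      (f' := fun x => fderiv ℝ (ξ ((j : Fin (l + 1)).pred (hinner j j.2).1)) x)
      (by rw [hbd]; exact hlosa j) (by rw [hbd]; exact hlod j)
  choose M hMv hMd hMgen using hM
  have e2 : ∀ j : {j // j ∈ B}, of (M j) - of (Ob j) ∈ soloInformedScissorsRel := by
    intro j
    have h0 := (hinner j j.2).1
    have hl := (hinner j j.2).2
    refine soloInformed_of_sub_of_mem_scissorsRel_of_subset (hMv j) (hObv j) ?_ ?_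
    · -- the open band lies in the closed band
      intro z hz
      rw [hObd, mem_bandOver_iff, bandLower_of_ne_zero ξ j h0, bandUpper_of_ne_last ξ j hl,
        EReal.coe_lt_coe_iff, EReal.coe_lt_coe_iff] at hz
      simp only [hMd, mem_setOf_eq, hbd, hbi, hlo, hhi]
      exact ⟨hz.1, hz.2.1.le, by linarith [hz.2.2]⟩
    · -- the difference consists of two graphs
      refine measure_mono_null (fun z hz => ?_)
        (measure_union_null (volume_graph_eq_zero (hlosa j)) (volume_graph_eq_zero (hhisa j)))
      obtain ⟨hz, hz'⟩ := hz
      simp only [hMd, mem_setOf_eq, hbd, hbi] at hz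
      obtain ⟨hzC, h1, h2⟩ := hz
      have h2' : z (Fin.last m) ≤ (bandUpper ξ j (Fin.init z)).toReal := by linarith
      rcases h1.lt_or_eq with h1 | h1
      · rcases h2'.lt_or_eq with h2' | h2'
        · refine absurd ?_ hz'
          rw [hObd, mem_bandOver_iff, bandLower_of_ne_zero ξ j h0, bandUpper_of_ne_last ξ j hl,
            EReal.coe_lt_coe_iff, EReal.coe_lt_coe_iff]
          refine ⟨hzC, ?_, ?_⟩
          · rwa [bandLower_of_ne_zero ξ j h0, EReal.toReal_coe] at h1
          · rwa [bandUpper_of_ne_last ξ j hl, EReal.toReal_coe] at h2'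
        · exact Or.inr ⟨hzC, h2'⟩
      · exact Or.inl ⟨hzC, h1.symm⟩
  -- Step 3: STACK the widths: the fibre length `L` over `C`
  let bL : IntegralRep m :=
    { domain := C
      integrand := fun x => ∑ j ∈ B.attach, (b j).integrand x
      isSemialgebraic_domain := hC
      isSemialgebraicFunOn_integrand := isSemialgebraicFunOn_finset_sum B.attach hC fun j _ =>
        hbd j ▸ (b j).isSemialgebraicFunOn_integrand
      integrableOn := integrable_finsetSum B.attach fun j _ => hbd j ▸ (b j).integrableOn }
  have e4 : of (soloInformedUnder bL) - ∑ j ∈ B.attach, of (soloInformedUnder (b j)) ∈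
      soloInformedScissorsRel :=
    soloInformed_under_sum_mem_scissorsRel B.attach C hC b (fun j _ => hbd j)
      (fun j _ x hx => hb0 j x hx) (fun j _ x hx => hwd j x hx) bL rfl fun x _ => rfl
  have hL : ∀ x, bL.integrand x =
      ∑ j ∈ B, ((bandUpper ξ j x).toReal - (bandLower ξ j x).toReal) := by
    intro x
    show ∑ j ∈ B.attach, (b j).integrand x = _
    simp_rw [hbi]
    exact Finset.sum_attach B fun j => (bandUpper ξ j x).toReal - (bandLower ξ j x).toReal
  -- Step 4: `U(C, L)` is `groundLast S` over `C` up to two null graphs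
  have hlen : ∀ x ∈ C, volume (FibreLength.fibre S x) = ENNReal.ofReal (bL.integrand x) :=
    fun x hx => by rw [hL]; exact volume_fibre_eq_ofReal_sum ξ (hmono x hx) G B hinner (hfib x hx)
  have e5 : of (soloInformedUnder bL) - of r' ∈ soloInformedScissorsRel := by
    refine soloInformed_of_sub_of_mem_scissorsRel_of_subset (soloInformed_isVolRep_under bL) hr'1
      ?_ ?_
    · intro z hz
      rw [hr'd] at hz
      obtain ⟨hzG, hzC⟩ := hz
      have hzC : Fin.init z ∈ C := hzC
      rw [Grounding.mem_groundLast_iff, hlen _ hzC, ENNReal.ofReal_lt_ofReal_iff'] at hzG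
      exact (soloInformed_mem_under_domain bL z).2 ⟨hzC, hzG.1.le, hzG.2.1.le⟩
    · have hzero : IsSemialgebraicFunOn ℚ C fun _ => (0 : ℝ) := by
        simpa using isSemialgebraicFunOn_ratCast hC 0
      refine measure_mono_null (fun z hz => ?_) (measure_union_null (volume_graph_eq_zero hzero)
        (volume_graph_eq_zero bL.isSemialgebraicFunOn_integrand))
      obtain ⟨hz, hz'⟩ := hz
      rw [hr'd] at hz'
      obtain ⟨hzC, h1, h2⟩ := (soloInformed_mem_under_domain bL z).1 hz
      have hzC : Fin.init z ∈ C := hzC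
      rcases h1.lt_or_eq with h1 | h1
      · rcases h2.lt_or_eq with h2 | h2
        · refine absurd ⟨Grounding.mem_groundLast_iff.2 ⟨h1, ?_⟩, hzC⟩ hz'
          rw [hlen _ hzC]
          exact (ENNReal.ofReal_lt_ofReal_iff_of_nonneg h1.le).2 h2
        · exact Or.inr ⟨hzC, h2⟩
      · exact Or.inl ⟨hzC, h1.symm⟩
  -- assembly
  have e2s : ∑ j ∈ B.attach, of (M j) - ∑ j ∈ B.attach, of (Ob j) ∈ soloInformedScissorsRel :=
    soloInformed_sum_sub_sum_mem_scissorsRel B.attach (fun j => of (M j)) (fun j => of (Ob j))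
      fun j _ => e2 j
  have e3s : ∑ j ∈ B.attach, of (soloInformedUnder (b j)) - ∑ j ∈ B.attach, of (M j) ∈
      soloInformedScissorsRel :=
    soloInformed_sum_sub_sum_mem_scissorsRel B.attach (fun j => of (soloInformedUnder (b j)))
      (fun j => of (M j)) fun j _ => soloInformed_mapGen_subset_scissorsRel (hMgen j)
  have : of r - of r' = (of r - of rU) + (of rU - ∑ j ∈ B.attach, of (Ob j)) -
      (∑ j ∈ B.attach, of (M j) - ∑ j ∈ B.attach, of (Ob j)) -
      (∑ j ∈ B.attach, of (soloInformedUnder (b j)) - ∑ j ∈ B.attach, of (M j)) -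
      (of (soloInformedUnder bL) - ∑ j ∈ B.attach, of (soloInformedUnder (b j))) +
      (of (soloInformedUnder bL) - of r') := by abel
  rw [this]
  exact add_mem (sub_mem (sub_mem (sub_mem (add_mem e0 e1) e2s) e3s) e4) e5

end Summit.KontsevichZagierPeriods.KontsevichZagierPeriods.Theorems

end
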